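import Mathlib
import Summits.ABC.ABC.Theorems.SoloInformedOnePrime

/-!
# Theorem B from Theorem A — counting and valuation lemmas for the pair `(2u/v, u/v)`

Algebraic bookkeeping for the kernel derivation of the report's Theorem B from Bugeaud–Laurent's
Théorème 1 (γ = 1/2): for odd coprime `u ≠ v` prime to the odd prime `p`, with `α₁ = 2u/v`,
`α₂ = u/v`,
* `(r,s) ↦ α₁^r α₂^s` is injective (2-adic valuation, then `α₂ ≠ 1`);
* multiplicative independence of `α₁, α₂`;
* modulo `p`, a coincidence `(2ȳ)^r ȳ^s = (2ȳ)^{r'} ȳ^{s'}` with `r+s = r'+s'` forces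
  `r ≡ r' (mod ord_p 2)` — the injectivity behind hypothesis (1b);
* `v_p(α₁^e - α₂^e) = v_p(2^e - 1)`;
* a pigeonhole in a finite subgroup, and the lower bound `(∏_{k<K} k!)^(-2/(K²-K)) ≥ 1/(K-1)`.
(solo-ABC-informed, paper §2.3.)
-/

namespace Summit.ABC.ABC.Theorems

open Finset

/-- `v_p(q^m) = m·v_p(q)` for `m : ℤ`. -/
theorem soloInformed_padicValRat_zpow {p : ℕ} [Fact p.Prime] (q : ℚ) (m : ℤ) :
    padicValRat p (q ^ m) = m * padicValRat p q := by
  rcases Int.eq_nat_or_neg m with ⟨k, rfl | rfl⟩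
  · rw [zpow_natCast, padicValRat.pow]
  · rw [zpow_neg, zpow_natCast, padicValRat.inv, padicValRat.pow]; ring

section pair

variable {p u v : ℕ}

/-- The 2-adic valuations: `v₂(u/v) = 0`, `v₂(2u/v) = 1` for odd `u, v`. -/
theorem soloInformed_padicValRat_two_pair (hu : Odd u) (hv : Odd v) :
    padicValRat 2 ((u : ℚ) / v) = 0 ∧ padicValRat 2 (((2 * u : ℕ) : ℚ) / v) = 1 := by
  have hu0 : u ≠ 0 := by rintro rfl; exact absurd hu (by decide)
  have hv0 : v ≠ 0 := by rintro rfl; exact absurd hv (by decide)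
  have hvu : padicValNat 2 u = 0 := padicValNat.eq_zero_of_not_dvd (Odd.not_two_dvd_nat hu)
  have hvv : padicValNat 2 v = 0 := padicValNat.eq_zero_of_not_dvd (Odd.not_two_dvd_nat hv)
  constructor
  · rw [padicValRat.div (by exact_mod_cast hu0) (by exact_mod_cast hv0), padicValRat.of_nat,
      padicValRat.of_nat, hvu, hvv]; simp
  · rw [padicValRat.div (by positivity) (by exact_mod_cast hv0), padicValRat.of_nat,
      padicValRat.of_nat, padicValNat.mul (by norm_num) hu0, hvu, hvv]
    simp

/-- `(r, s) ↦ (2u/v)^r (u/v)^s` is injective on `ℕ × ℕ` (`u ≠ v` odd). -/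
theorem soloInformed_pair_pow_injective (hu : Odd u) (hv : Odd v) (huv : u ≠ v) :
    Function.Injective
      (fun rs : ℕ × ℕ => ((((2 * u : ℕ) : ℚ) / v) ^ rs.1 * ((u : ℚ) / v) ^ rs.2)) := by
  have hu0 : u ≠ 0 := by rintro rfl; exact absurd hu (by decide)
  have hv0 : v ≠ 0 := by rintro rfl; exact absurd hv (by decide)
  obtain ⟨h20, h21⟩ := soloInformed_padicValRat_two_pair hu hv
  have hα₂0 : ((u : ℚ) / v) ≠ 0 := by positivity
  have hα₁0 : (((2 * u : ℕ) : ℚ) / v) ≠ 0 := by positivity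
  rintro ⟨r, s⟩ ⟨r', s'⟩ h
  simp only at h
  have hval := congrArg (padicValRat 2) h
  rw [padicValRat.mul (pow_ne_zero _ hα₁0) (pow_ne_zero _ hα₂0),
    padicValRat.mul (pow_ne_zero _ hα₁0) (pow_ne_zero _ hα₂0),
    padicValRat.pow, padicValRat.pow, padicValRat.pow, padicValRat.pow,
    h20, h21] at hval
  simp only [mul_one, mul_zero, add_zero, Nat.cast_inj] at hval
  subst hval
  have h2 : ((u : ℚ) / v) ^ s = ((u : ℚ) / v) ^ s' :=
    mul_left_cancel₀ (pow_ne_zero _ hα₁0) h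
  have hne1 : ((u : ℚ) / v) ≠ 1 := by
    intro h1
    rw [div_eq_one_iff_eq (by exact_mod_cast hv0)] at h1
    exact huv (by exact_mod_cast h1)
  have := pow_right_injective₀ (by positivity : (0 : ℚ) < (u : ℚ) / v) hne1 h2
  simp [this]

/-- Multiplicative independence of `2u/v` and `u/v` (`u ≠ v` odd). -/
theorem soloInformed_pair_independent (hu : Odd u) (hv : Odd v) (huv : u ≠ v) (m n : ℤ)
    (h : (((2 * u : ℕ) : ℚ) / v) ^ m * ((u : ℚ) / v) ^ n = 1) : m = 0 ∧ n = 0 := by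
  have hu0 : u ≠ 0 := by rintro rfl; exact absurd hu (by decide)
  have hv0 : v ≠ 0 := by rintro rfl; exact absurd hv (by decide)
  obtain ⟨h20, h21⟩ := soloInformed_padicValRat_two_pair hu hv
  have hα₂0 : ((u : ℚ) / v) ≠ 0 := by positivity
  have hα₁0 : (((2 * u : ℕ) : ℚ) / v) ≠ 0 := by positivity
  have hval := congrArg (padicValRat 2) h
  rw [padicValRat.mul (zpow_ne_zero _ hα₁0) (zpow_ne_zero _ hα₂0),
    soloInformed_padicValRat_zpow, soloInformed_padicValRat_zpow, h20, h21,
    padicValRat.one] at hval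
  simp only [mul_one, mul_zero, add_zero] at hval
  have hm : m = 0 := by exact_mod_cast hval
  subst hm
  refine ⟨rfl, ?_⟩
  rw [zpow_zero, one_mul] at h
  have hne1 : ((u : ℚ) / v) ≠ 1 := by
    intro h1
    rw [div_eq_one_iff_eq (by exact_mod_cast hv0)] at h1
    exact huv (by exact_mod_cast h1)
  have := zpow_right_injective₀ (by positivity : (0 : ℚ) < (u : ℚ) / v) hne1 (h.trans (zpow_zero _).symm)
  exact this

/-- `v_p((2u/v)^e - (u/v)^e) = v_p(2^e - 1)` for `p ∤ u v`, `e ≥ 1`. -/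
theorem soloInformed_padicValRat_pair_pow_sub [Fact p.Prime] (hu0 : u ≠ 0) (hv0 : v ≠ 0)
    (hpu : ¬ p ∣ u) (hpv : ¬ p ∣ v) {e : ℕ} (he : 1 ≤ e) :
    padicValRat p ((((2 * u : ℕ) : ℚ) / v) ^ e - ((u : ℚ) / v) ^ e)
      = padicValNat p (2 ^ e - 1) := by
  have hα₂0 : ((u : ℚ) / v) ≠ 0 := by positivity
  have h1 : (((2 * u : ℕ) : ℚ) / v) ^ e - ((u : ℚ) / v) ^ e
      = ((u : ℚ) / v) ^ e * (((2 ^ e - 1 : ℕ) : ℚ)) := by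
    have h2e : 1 ≤ 2 ^ e := Nat.one_le_two_pow
    push_cast [Nat.cast_sub h2e]
    ring
  have hM : ((2 ^ e - 1 : ℕ) : ℚ) ≠ 0 := by
    have : 1 < 2 ^ e := Nat.one_lt_two_pow (by omega)
    exact_mod_cast (show 2 ^ e - 1 ≠ 0 by omega)
  rw [h1, padicValRat.mul (pow_ne_zero _ hα₂0) hM, padicValRat.pow,
    padicValRat.div (by exact_mod_cast hu0) (by exact_mod_cast hv0), padicValRat.of_nat,
    padicValRat.of_nat, padicValRat.of_nat, padicValNat.eq_zero_of_not_dvd hpu,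
    padicValNat.eq_zero_of_not_dvd hpv]
  simp

/-- Modulo `p`: a coincidence `(u₂·w)^r w^s = (u₂·w)^{r'} w^{s'}` with `r + s = r' + s'`
forces `r ≡ r' (mod ord u₂)`. -/
theorem soloInformed_class_collision {G : Type*} [CommGroup G] (u₂ w : G) {r s r' s' : ℕ}
    (hsum : r + s = r' + s') (h : (u₂ * w) ^ r * w ^ s = (u₂ * w) ^ r' * w ^ s') :
    r ≡ r' [MOD orderOf u₂] := by
  have h1 : (u₂ * w) ^ r * w ^ s = u₂ ^ r * w ^ (r + s) := by rw [mul_pow, pow_add, mul_assoc]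
  have h2 : (u₂ * w) ^ r' * w ^ s' = u₂ ^ r' * w ^ (r' + s') := by rw [mul_pow, pow_add, mul_assoc]
  rw [h1, h2, hsum] at h
  have h3 : u₂ ^ r = u₂ ^ r' := mul_right_cancel h
  exact pow_eq_pow_iff_modEq.mp h3

/-- Injectivity behind (1b): on a class `{(2ȳ)^r ȳ^s = κ}` inside `[0,R) × [0,S)` with
`R ≤ ord u₂` or `S ≤ ord u₂`, the map `(r,s) ↦ r·e + s·e` (`e > 0`) is injective. -/
theorem soloInformed_class_injOn {G : Type*} [CommGroup G] [DecidableEq G] (u₂ w κ : G)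
    {R S e : ℕ} (he : 0 < e) (hRS : R ≤ orderOf u₂ ∨ S ≤ orderOf u₂) :
    Set.InjOn (fun rs : ℕ × ℕ => rs.1 * e + rs.2 * e)
      ↑((Finset.range R ×ˢ Finset.range S).filter
          (fun rs : ℕ × ℕ => (u₂ * w) ^ rs.1 * w ^ rs.2 = κ)) := by
  rintro ⟨r, s⟩ hrs ⟨r', s'⟩ hrs' hE
  simp only [Finset.coe_filter, Finset.mem_product, Finset.mem_range, Set.mem_setOf_eq] at hrs hrs'
  simp only at hE
  have hsum : r + s = r' + s' := by
    have : (r + s) * e = (r' + s') * e := by rw [add_mul, add_mul]; exact hE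
    exact Nat.eq_of_mul_eq_mul_right he this
  have hmod := soloInformed_class_collision u₂ w hsum (hrs.2.trans hrs'.2.symm)
  rcases hRS with hR | hS
  · have hrr : r = r' :=
      Nat.ModEq.eq_of_lt_of_lt hmod (lt_of_lt_of_le hrs.1.1 hR) (lt_of_lt_of_le hrs'.1.1 hR)
    subst hrr
    have : s = s' := by omega
    simp [this]
  · have hss : s ≡ s' [MOD orderOf u₂] := Nat.ModEq.add_left_cancel hmod (by rw [hsum])
    have hss' : s = s' :=
      Nat.ModEq.eq_of_lt_of_lt hss (lt_of_lt_of_le hrs.1.2 hS) (lt_of_lt_of_le hrs'.1.2 hS)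
    subst hss'
    have : r = r' := by omega
    simp [this]

end pair

/-- Pigeonhole in a finite subgroup: a map from `[0,R) × [0,S)` into a subgroup `H` with
`|H|·n < R·S` has a fibre with more than `n` points. -/
theorem soloInformed_exists_large_class {G : Type*} [Group G] [Fintype G] [DecidableEq G]
    (H : Subgroup G) (f : ℕ × ℕ → G) (hf : ∀ rs, f rs ∈ H) (R S n : ℕ)
    (h : Nat.card H * n < R * S) :
    ∃ w : G, n < ((Finset.range R ×ˢ Finset.range S).filter (fun rs => f rs = w)).card := by
  classical
  set t : Finset G := (H : Set G).toFinset with ht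
  have htcard : t.card = Nat.card H := by
    rw [ht, Set.toFinset_card, ← Nat.card_eq_fintype_card]; rfl
  have hmaps : ∀ a ∈ Finset.range R ×ˢ Finset.range S, f a ∈ t := by
    intro a _; rw [ht, Set.mem_toFinset]; exact hf a
  have hlt : t.card * n < (Finset.range R ×ˢ Finset.range S).card := by
    rw [htcard, Finset.card_product, Finset.card_range, Finset.card_range]; exact h
  obtain ⟨w, -, hw⟩ := Finset.exists_lt_card_fiber_of_mul_lt_card_of_maps_to hmaps hlt
  exact ⟨w, hw⟩

/-- Lower bound for the factorial factor: `1/(K-1) ≤ (∏_{k<K} k!)^(-2/(K²-K))` (`K ≥ 2`). -/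
theorem soloInformed_factorialProd_rpow_ge (K : ℕ) (hK : 2 ≤ K) :
    1 / ((K : ℝ) - 1) ≤ (∏ k ∈ range K, (k.factorial : ℝ)) ^ (-(2 : ℝ) / ((K : ℝ) ^ 2 - K)) := by
  have hKr : (2 : ℝ) ≤ K := by exact_mod_cast hK
  have hK1 : (0 : ℝ) < (K : ℝ) - 1 := by linarith
  have hP : (0 : ℝ) < ∏ k ∈ range K, (k.factorial : ℝ) :=
    prod_pos fun k _ => by exact_mod_cast Nat.factorial_pos k
  rw [Real.rpow_def_of_pos hP, Real.log_prod (fun k _ => by exact_mod_cast (Nat.factorial_pos k).ne')]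
  -- log k! ≤ k log (K-1) for k < K
  have hlogk : ∀ k ∈ range K, Real.log (k.factorial : ℝ) ≤ k * Real.log ((K : ℝ) - 1) := by
    intro k hk
    rw [Finset.mem_range] at hk
    rcases Nat.eq_zero_or_pos k with rfl | hk0
    · simp
    have h1 : (k.factorial : ℝ) ≤ (k : ℝ) ^ k := by exact_mod_cast Nat.factorial_le_pow k
    have h2 : ((k : ℝ)) ^ k ≤ ((K : ℝ) - 1) ^ k := by
      apply pow_le_pow_left₀ (by positivity)
      have : (k : ℝ) + 1 ≤ K := by exact_mod_cast hk
      linarith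
    calc Real.log (k.factorial : ℝ) ≤ Real.log (((K : ℝ) - 1) ^ k) :=
          Real.log_le_log (by exact_mod_cast Nat.factorial_pos k) (h1.trans h2)
      _ = k * Real.log ((K : ℝ) - 1) := by rw [Real.log_pow]
  have hsum : ∑ k ∈ range K, Real.log (k.factorial : ℝ) ≤ (K : ℝ) * ((K : ℝ) - 1) / 2 * Real.log ((K : ℝ) - 1) := by
    calc ∑ k ∈ range K, Real.log (k.factorial : ℝ) ≤ ∑ k ∈ range K, (k : ℝ) * Real.log ((K : ℝ) - 1) :=
          sum_le_sum hlogk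
      _ = (∑ k ∈ range K, (k : ℝ)) * Real.log ((K : ℝ) - 1) := by rw [sum_mul]
      _ = (K : ℝ) * ((K : ℝ) - 1) / 2 * Real.log ((K : ℝ) - 1) := by
          congr 1
          have h0 := Finset.sum_range_id_mul_two K
          have h' : ((∑ k ∈ range K, k : ℕ) : ℝ) * 2 = (K : ℝ) * ((K - 1 : ℕ) : ℝ) := by
            exact_mod_cast h0
          push_cast [Nat.cast_sub (by omega : 1 ≤ K)] at h'
          linarith
  have hx : -(2 : ℝ) / ((K : ℝ) ^ 2 - K) ≤ 0 :=
    div_nonpos_of_nonpos_of_nonneg (by norm_num) (by nlinarith)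
  have h1 : (K : ℝ) * ((K : ℝ) - 1) / 2 * Real.log ((K : ℝ) - 1) * (-(2 : ℝ) / ((K : ℝ) ^ 2 - K))
      = -Real.log ((K : ℝ) - 1) := by
    field_simp
  have h2 := mul_le_mul_of_nonpos_right hsum hx
  rw [h1] at h2
  calc 1 / ((K : ℝ) - 1) = Real.exp (-Real.log ((K : ℝ) - 1)) := by
        rw [Real.exp_neg, Real.exp_log hK1, one_div]
    _ ≤ _ := Real.exp_le_exp.mpr h2

end Summit.ABC.ABC.Theorems
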